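import Literature.MathematicalPhysics.QuantumLattice.HubbardTwoPointLimitReduction
import Literature.MathematicalPhysics.QuantumLattice.HubbardFreePropagatorTorusDecay
import Literature.Probability.LatticeModels.TorusCentredLift
import HarnessLib

/-!
# The thermodynamic limit of the truncated coefficients `t_j(L)` (order by order)

Topic `MathematicalPhysics/QuantumLattice`; programme under the tree's fact `bgm_two_point_limit`
(`HubbardFermiLiquid.lean`; Benfatto–Giuliani–Mastropietro, Ann. Henri Poincaré 7 (2006) 809).
`HubbardLinkedCluster.lean` writes the torus two-point function as `Σ_j U^j t_j(L)` with
`t_j(L) = (-β)^j ∫_{Δ_j} Σ_{x⃗ ∈ Λ_L^j} 𝓔ᵀ_j` (`hubbardTorusTruncatedCoeff`), and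
`HubbardTwoPointLimitReduction.lean` reduces the fact to (A) volume-uniform geometric bounds on
`t_j(L)` and (B) the termwise limits `t_j(L) → τ_j`. This file begins (B): the BRIDGE from the
propagator matrices of the linked-cluster coefficients to the free torus propagator of
`HubbardFreePropagatorLimit` / `…TimePeriodization` / `…TorusDecay`, and the entrywise limit.

* `torusWordMatrix β μ L x y σ σ' Z τ` — the `(2j+1)×(2j+1)` propagator matrix of the two-point
  word with the `j` vertices at INTEGER positions `Z : Fin j → ℤ²` (projected to the torus), written
  with `hubbardThermalTwoPointEvolved β 0 μ L` (creation first; the annihilation-first branch of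
  BGM (1.4) is the creation-first propagator at the time shifted by `-β`, KMS);
* `twoPointPropMatrix_torus_eq` — **bridge**: for `L ≥ 1` the matrix `twoPointPropMatrix` of
  `HubbardLinkedCluster` for the torus one-body operator and vertices `proj ∘ Z` IS `torusWordMatrix`
  (`thermalCorr_dGamma_evolve_creation_annihilation` and the matrix identity
  `(1 + e^{-βh})⁻¹ = e^{βh}(1 + e^{βh})⁻¹`);
* `infWordMatrix` — the same matrix with the infinite-volume propagator
  `g(τ, z) = freePropagatorInfiniteTime β μ τ z`, and `tendsto_torusWordMatrix` — entrywise
  convergence as `L → ∞` (`tendsto_hubbardThermalTwoPointEvolved_zero_interaction'`);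
* `tendsto_twoPointUrsellZ` — hence the truncated expectation of the word with vertices at fixed
  integer positions converges to its infinite-volume value `twoPointUrsellInf` (continuity of the
  Ursell function of the determinant moments in the matrix entries).

Everything is PROVED; the definitions are the position/spin bookkeeping of the word and the two
matrices.

## References

* G. Benfatto, A. Giuliani, V. Mastropietro, Ann. Henri Poincaré 7 (2006) 809–898, §1 (1.2)–(1.4),
  §2.1–2.2 (2.4), (2.8), (2.14), §2.3 footnote 1 (arXiv:cond-mat/0507686 pp. 2, 5–6, 8).
  [BenfattoGiulianiMastropietro2006]
* O. Bratteli, D. W. Robinson, *Operator Algebras and Quantum Statistical Mechanics 2*, 2nd ed.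
  (1997), §5.2.4 (quasi-free KMS two-point functions). [BratteliRobinson1997]
-/

noncomputable section

open scoped Matrix.Norms.L2Operator ComplexOrder
open Finset MeasureTheory Filter Topology NormedSpace
open Literature.Probability.LatticeModels

namespace Literature.MathematicalPhysics.QuantumLattice

/-! ### A matrix identity: the annihilation-first Fermi matrix -/

section FermiMatrix

variable {ι : Type*} [LinearOrder ι] [Fintype ι]

/-- `(1 + e^{-βh})⁻¹ = e^{βh} (1 + e^{βh})⁻¹` for Hermitian `h` (KMS at the one-body level).
[folklore] -/
theorem inv_one_add_exp_neg_smul {h : Matrix ι ι ℂ} (hh : h.IsHermitian) (β : ℝ) :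
    (1 + exp (-((β : ℂ) • h)))⁻¹ = exp ((β : ℂ) • h) * (1 + exp ((β : ℂ) • h))⁻¹ := by
  have h1 : IsUnit (1 + exp ((β : ℂ) • h)).det :=
    ((posDef_one_add_exp_smul hh β).isUnit).map Matrix.detMonoidHom
  have hmul : (1 + exp ((β : ℂ) • h)) * (1 + exp ((β : ℂ) • h))⁻¹ = 1 := Matrix.mul_nonsing_inv _ h1
  rw [← one_sub_fermiMatrix hh β]
  calc 1 - (1 + exp ((β : ℂ) • h))⁻¹
      = (1 + exp ((β : ℂ) • h)) * (1 + exp ((β : ℂ) • h))⁻¹ - 1 * (1 + exp ((β : ℂ) • h))⁻¹ := by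
        rw [hmul, Matrix.one_mul]
    _ = exp ((β : ℂ) • h) * (1 + exp ((β : ℂ) • h))⁻¹ := by
        rw [← Matrix.sub_mul, add_sub_cancel_left]

/-- `e^{-sh} (1 + e^{-βh})⁻¹ e^{th} = e^{-(s-β)h} (1 + e^{βh})⁻¹ e^{th}`. [folklore] -/
theorem exp_neg_mul_inv_one_add_exp_neg_mul_exp {h : Matrix ι ι ℂ} (hh : h.IsHermitian) (β : ℝ)
    (s t : ℂ) :
    exp (-(s • h)) * (1 + exp (-((β : ℂ) • h)))⁻¹ * exp (t • h) =
      exp (-((s - β) • h)) * (1 + exp ((β : ℂ) • h))⁻¹ * exp (t • h) := by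
  rw [inv_one_add_exp_neg_smul hh β, ← Matrix.mul_assoc]
  congr 2
  rw [← Matrix.exp_add_of_commute (-(s • h)) ((β : ℂ) • h)
    (((Commute.refl h).smul_left s).smul_right (β : ℂ)).neg_left]
  congr 1
  rw [sub_smul, neg_sub', sub_neg_eq_add]

end FermiMatrix

/-! ### The word with vertices at integer positions -/

section Word

variable {j : ℕ}

/-- The positions of the `2j+1` pairs of the two-point word with the external orbital at `x` and
vertex `i` at `Z i`: position `0 ↦ x`, position `1 + 2i + j' ↦ Z i`. [folklore] -/
def hubbardWordPos (x : Site 2) (Z : Fin j → Site 2) : Fin (j * 2 + 1) → Site 2 :=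
  Fin.cons x fun m => Z (finProdFinEquiv.symm m).1

/-- The spins of the pairs: `0 ↦ σ`, `1 + 2i + j' ↦ j'`. [folklore] -/
def hubbardWordSpin (σ : Fin 2) : Fin (j * 2 + 1) → Fin 2 :=
  Fin.cons σ fun m => (finProdFinEquiv.symm m).2

/-- The (real) times of the pairs: `0 ↦ 0`, `1 + 2i + j' ↦ w i`. [folklore] -/
def hubbardWordTimeR (w : Fin j → ℝ) : Fin (j * 2 + 1) → ℝ :=
  Fin.cons 0 fun m => w (finProdFinEquiv.symm m).1

/-- The external pair sits at `x`. [folklore] -/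
@[simp] theorem hubbardWordPos_zero (x : Site 2) (Z : Fin j → Site 2) : hubbardWordPos x Z 0 = x := rfl

/-- The pairs of vertex `i` sit at `Z i`. [folklore] -/
@[simp] theorem hubbardWordPos_succ (x : Site 2) (Z : Fin j → Site 2) (m : Fin (j * 2)) :
    hubbardWordPos x Z m.succ = Z (finProdFinEquiv.symm m).1 := by simp [hubbardWordPos]

/-- The external pair carries the spin `σ`. [folklore] -/
@[simp] theorem hubbardWordSpin_zero (σ : Fin 2) : hubbardWordSpin (j := j) σ 0 = σ := rfl

/-- The `j'`-pair of a vertex carries the spin `j'`. [folklore] -/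
@[simp] theorem hubbardWordSpin_succ (σ : Fin 2) (m : Fin (j * 2)) :
    hubbardWordSpin σ m.succ = (finProdFinEquiv.symm m).2 := by simp [hubbardWordSpin]

/-- The external pair sits at time `0`. [folklore] -/
@[simp] theorem hubbardWordTimeR_zero (w : Fin j → ℝ) : hubbardWordTimeR w 0 = 0 := rfl

/-- The pairs of vertex `i` sit at time `w i`. [folklore] -/
@[simp] theorem hubbardWordTimeR_succ (w : Fin j → ℝ) (m : Fin (j * 2)) :
    hubbardWordTimeR w m.succ = w (finProdFinEquiv.symm m).1 := by simp [hubbardWordTimeR]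

/-- The complex word times of real times are the real word times. [folklore] -/
theorem hubbardWordTime_ofReal (w : Fin j → ℝ) (a : Fin (j * 2 + 1)) :
    hubbardWordTime (fun i => ((w i : ℝ) : ℂ)) a = ((hubbardWordTimeR w a : ℝ) : ℂ) := by
  induction a using Fin.cases with
  | zero => simp
  | succ m => simp

/-- The orbitals of the word with vertices `proj ∘ Z`: the torus orbital at the projected word
position with the word spin. [folklore] -/
theorem hubbardWordOrb_proj {L : ℕ} [NeZero L] (x : Site 2) (σ : Fin 2) (Z : Fin j → Site 2)
    (a : Fin (j * 2 + 1)) :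
    hubbardWordOrb (orb (FermionTorus.ofTorusSite (Torus.proj L x)) σ)
        (fun i => FermionTorus.ofTorusSite (Torus.proj L (Z i))) a =
      orb (FermionTorus.ofTorusSite (Torus.proj L (hubbardWordPos x Z a))) (hubbardWordSpin σ a) := by
  induction a using Fin.cases with
  | zero => simp
  | succ m => simp

end Word

/-! ### The bridge to the free torus propagator -/

section Bridge

variable (β μ : ℝ) {L : ℕ} [NeZero L]

/-- **The creation-first entries are the evolved free two-point function**:
`[e^{-sh} (1+e^{βh})⁻¹ e^{th}]_{(ȳ,σ₂),(x̄,σ₁)} = ⟨a⁺_{xσ₁}(t) a⁻_{yσ₂}(s)⟩_{β,L,U=0}` for the torus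
one-body operator `h = hubbardOneBody (fermionTorusGraph 2 L) 1 μ`. [cite: BenfattoGiulianiMastropietro2006, eq. (1.4)] -/
theorem fermi_evolve_apply_eq_hubbardThermalTwoPointEvolved (x₁ y₁ : Site 2) (σ₁ σ₂ : Fin 2) (t s : ℂ) :
    (exp (-(s • hubbardOneBody (fermionTorusGraph 2 L) 1 μ)) *
        (1 + exp ((β : ℂ) • hubbardOneBody (fermionTorusGraph 2 L) 1 μ))⁻¹ *
        exp (t • hubbardOneBody (fermionTorusGraph 2 L) 1 μ))
        (orb (FermionTorus.ofTorusSite (Torus.proj L y₁)) σ₂)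
        (orb (FermionTorus.ofTorusSite (Torus.proj L x₁)) σ₁) =
      hubbardThermalTwoPointEvolved β 0 μ L x₁ σ₁ t y₁ σ₂ s := by
  have hh := isHermitian_hubbardOneBody (fermionTorusGraph 2 L) 1 μ
  have key : Matrix.thermalCorr β (dGamma (hubbardOneBody (fermionTorusGraph 2 L) 1 μ))
      (exp (t • dGamma (hubbardOneBody (fermionTorusGraph 2 L) 1 μ)) *
          creation (orb (FermionTorus.ofTorusSite (Torus.proj L x₁)) σ₁) *
        exp (-(t • dGamma (hubbardOneBody (fermionTorusGraph 2 L) 1 μ))))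
      (exp (s • dGamma (hubbardOneBody (fermionTorusGraph 2 L) 1 μ)) *
          annihilation (orb (FermionTorus.ofTorusSite (Torus.proj L y₁)) σ₂) *
        exp (-(s • dGamma (hubbardOneBody (fermionTorusGraph 2 L) 1 μ)))) =
      (exp (-(s • hubbardOneBody (fermionTorusGraph 2 L) 1 μ)) *
        (1 + exp ((β : ℂ) • hubbardOneBody (fermionTorusGraph 2 L) 1 μ))⁻¹ *
        exp (t • hubbardOneBody (fermionTorusGraph 2 L) 1 μ))
        (orb (FermionTorus.ofTorusSite (Torus.proj L y₁)) σ₂)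
        (orb (FermionTorus.ofTorusSite (Torus.proj L x₁)) σ₁) := by
    convert thermalCorr_dGamma_evolve_creation_annihilation hh β s t
      (orb (FermionTorus.ofTorusSite (Torus.proj L x₁)) σ₁)
      (orb (FermionTorus.ofTorusSite (Torus.proj L y₁)) σ₂) using 8
  unfold hubbardThermalTwoPointEvolved
  rw [dif_neg (NeZero.ne L),
    show hubbardTorusWith 2 L 1 0 μ = hamiltonianWith (fermionTorusGraph 2 L) 1 0 μ from rfl,
    hamiltonianWith_zero_eq_dGamma, key]

/-- **The annihilation-first entries are the evolved free two-point function at the time shifted by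
`-β`** (KMS): `[e^{-sh} (1+e^{-βh})⁻¹ e^{th}]_{(ȳ,σ₂),(x̄,σ₁)} = ⟨a⁺_{xσ₁}(t) a⁻_{yσ₂}(s - β)⟩_{β,L,U=0}`.
[cite: BenfattoGiulianiMastropietro2006, eq. (1.4)] -/
theorem fermi_evolve_neg_apply_eq_hubbardThermalTwoPointEvolved (x₁ y₁ : Site 2) (σ₁ σ₂ : Fin 2)
    (t s : ℂ) :
    (exp (-(s • hubbardOneBody (fermionTorusGraph 2 L) 1 μ)) *
        (1 + exp (-((β : ℂ) • hubbardOneBody (fermionTorusGraph 2 L) 1 μ)))⁻¹ *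
        exp (t • hubbardOneBody (fermionTorusGraph 2 L) 1 μ))
        (orb (FermionTorus.ofTorusSite (Torus.proj L y₁)) σ₂)
        (orb (FermionTorus.ofTorusSite (Torus.proj L x₁)) σ₁) =
      hubbardThermalTwoPointEvolved β 0 μ L x₁ σ₁ t y₁ σ₂ (s - β) := by
  have hM := exp_neg_mul_inv_one_add_exp_neg_mul_exp
    (isHermitian_hubbardOneBody (fermionTorusGraph 2 L) 1 μ) β s t
  have happ := congr_fun (congr_fun hM (orb (FermionTorus.ofTorusSite (Torus.proj L y₁)) σ₂))
    (orb (FermionTorus.ofTorusSite (Torus.proj L x₁)) σ₁)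
  rw [← fermi_evolve_apply_eq_hubbardThermalTwoPointEvolved β μ x₁ y₁ σ₁ σ₂ t (s - β)]
  -- the two sides differ from `happ` only through the instance paths on `Orb (FermionTorus 2 L)`
  convert happ using 8

variable (L)

/-- **The propagator matrix of the two-point word with vertices at integer positions**, written with
the evolved free torus two-point function: entry `(a, b)` is
`⟨a⁺_{pos_a}(τ_a) a⁻_{pos_b}(τ_b)⟩_{β,L,0}` for `a ≤ b` and `-⟨a⁺_{pos_a}(τ_a) a⁻_{pos_b}(τ_b - β)⟩_{β,L,0}`
for `a > b` (creation orbitals: external `(x, σ)`, vertex pairs `(Z i, j')`; annihilation orbitals: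
external `(y, σ')`, vertex pairs `(Z i, j')`). BGM 2006 (1.4), (2.8). [cite: BenfattoGiulianiMastropietro2006, §2.1 (2.8)] -/
def torusWordMatrix (x y : Site 2) (σ σ' : Fin 2) {j : ℕ} (Z : Fin j → Site 2) (τ : Fin j → ℂ) :
    Matrix (Fin (j * 2 + 1)) (Fin (j * 2 + 1)) ℂ :=
  Matrix.of fun a b =>
    if a ≤ b then
      hubbardThermalTwoPointEvolved β 0 μ L (hubbardWordPos x Z a) (hubbardWordSpin σ a) (hubbardWordTime τ a)
        (hubbardWordPos y Z b) (hubbardWordSpin σ' b) (hubbardWordTime τ b)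
    else
      -hubbardThermalTwoPointEvolved β 0 μ L (hubbardWordPos x Z a) (hubbardWordSpin σ a) (hubbardWordTime τ a)
        (hubbardWordPos y Z b) (hubbardWordSpin σ' b) (hubbardWordTime τ b - β)

variable {L}

/-- **Bridge**: the propagator matrix `twoPointPropMatrix` of `HubbardLinkedCluster` for the torus
one-body operator, external orbitals `(x̄, σ), (ȳ, σ')` and vertices `proj ∘ Z` is `torusWordMatrix`.
[cite: BenfattoGiulianiMastropietro2006, §2.1 (2.8)] -/
theorem twoPointPropMatrix_torus_eq (x y : Site 2) (σ σ' : Fin 2) {j : ℕ} (Z : Fin j → Site 2)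
    (τ : Fin j → ℂ) :
    twoPointPropMatrix β (hubbardOneBody (fermionTorusGraph 2 L) 1 μ)
        (orb (FermionTorus.ofTorusSite (Torus.proj L x)) σ)
        (orb (FermionTorus.ofTorusSite (Torus.proj L y)) σ')
        (fun i => FermionTorus.ofTorusSite (Torus.proj L (Z i))) τ =
      torusWordMatrix β μ L x y σ σ' Z τ := by
  ext a b
  unfold twoPointPropMatrix propMatrix torusWordMatrix
  rw [Matrix.of_apply, Matrix.of_apply, hubbardWordOrb_proj, hubbardWordOrb_proj]
  by_cases hab : a ≤ b
  · rw [if_pos hab, if_pos hab]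
    -- instance paths on `Orb (FermionTorus 2 L)` differ between the two files: `convert`
    convert fermi_evolve_apply_eq_hubbardThermalTwoPointEvolved (L := L) β μ (hubbardWordPos x Z a) (hubbardWordPos y Z b)
      (hubbardWordSpin σ a) (hubbardWordSpin σ' b) (hubbardWordTime τ a) (hubbardWordTime τ b) using 8
  · rw [if_neg hab, if_neg hab]
    refine congrArg Neg.neg ?_
    convert fermi_evolve_neg_apply_eq_hubbardThermalTwoPointEvolved (L := L) β μ (hubbardWordPos x Z a)
      (hubbardWordPos y Z b) (hubbardWordSpin σ a) (hubbardWordSpin σ' b) (hubbardWordTime τ a) (hubbardWordTime τ b) using 8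

end Bridge

/-! ### The infinite-volume matrix and the entrywise limit -/

section Limit

variable (β μ : ℝ)

/-- The infinite-volume creation-first free propagator with spins:
`δ_{σ₁σ₂} g(s - t, y₁ - x₁)`, `g = freePropagatorInfiniteTime β μ`. [cite: BenfattoGiulianiMastropietro2006, eq. (2.4)] -/
def freePropInf (x₁ : Site 2) (σ₁ : Fin 2) (t : ℂ) (y₁ : Site 2) (σ₂ : Fin 2) (s : ℂ) : ℂ :=
  if σ₁ = σ₂ then freePropagatorInfiniteTime β μ (s - t) (y₁ - x₁) else 0

/-- **The infinite-volume propagator matrix of the two-point word** with vertices at `Z` (the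
entrywise `L → ∞` limit of `torusWordMatrix`, see `tendsto_torusWordMatrix_apply`). BGM 2006 (2.4),
(2.8). [cite: BenfattoGiulianiMastropietro2006, §2.1 (2.8)] -/
def infWordMatrix (x y : Site 2) (σ σ' : Fin 2) {j : ℕ} (Z : Fin j → Site 2) (τ : Fin j → ℂ) :
    Matrix (Fin (j * 2 + 1)) (Fin (j * 2 + 1)) ℂ :=
  Matrix.of fun a b =>
    if a ≤ b then
      freePropInf β μ (hubbardWordPos x Z a) (hubbardWordSpin σ a) (hubbardWordTime τ a)
        (hubbardWordPos y Z b) (hubbardWordSpin σ' b) (hubbardWordTime τ b)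
    else
      -freePropInf β μ (hubbardWordPos x Z a) (hubbardWordSpin σ a) (hubbardWordTime τ a)
        (hubbardWordPos y Z b) (hubbardWordSpin σ' b) (hubbardWordTime τ b - β)

/-- **Entrywise thermodynamic limit of the propagator matrix** (periodization,
`tendsto_hubbardThermalTwoPointEvolved_zero_interaction'`). [cite: BenfattoGiulianiMastropietro2006, eq. (2.4)] -/
theorem tendsto_torusWordMatrix_apply (x y : Site 2) (σ σ' : Fin 2) {j : ℕ} (Z : Fin j → Site 2)
    (τ : Fin j → ℂ) (a b : Fin (j * 2 + 1)) :
    Tendsto (fun L : ℕ => torusWordMatrix β μ L x y σ σ' Z τ a b) atTop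
      (𝓝 (infWordMatrix β μ x y σ σ' Z τ a b)) := by
  simp only [torusWordMatrix, infWordMatrix, Matrix.of_apply]
  split_ifs with hab
  · exact tendsto_hubbardThermalTwoPointEvolved_zero_interaction' β μ _ _ _ _ _ _
  · exact (tendsto_hubbardThermalTwoPointEvolved_zero_interaction' β μ _ _ _ _ _ _).neg

/-- **The truncated expectation of the two-point word with vertices at integer positions** (torus of
side `L`): the Ursell function of the determinant moments of `torusWordMatrix` over the clusters
{external pair, vertices}. [cite: BenfattoGiulianiMastropietro2006, §2.2 (2.14)] -/
def twoPointUrsellZ (L : ℕ) (x y : Site 2) (σ σ' : Fin 2) {j : ℕ} (Z : Fin j → Site 2)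
    (τ : Fin j → ℂ) : ℂ :=
  ursellOf (FermionicTree.moment (hubbardCluster j) (torusWordMatrix β μ L x y σ σ' Z τ)) univ

/-- **Its infinite-volume counterpart** (the same Ursell function of the moments of
`infWordMatrix`). [cite: BenfattoGiulianiMastropietro2006, §2.2 (2.14)] -/
def twoPointUrsellInf (x y : Site 2) (σ σ' : Fin 2) {j : ℕ} (Z : Fin j → Site 2)
    (τ : Fin j → ℂ) : ℂ :=
  ursellOf (FermionicTree.moment (hubbardCluster j) (infWordMatrix β μ x y σ σ' Z τ)) univ

/-- The Ursell function of the determinant moments is a continuous function of the matrix.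
[folklore] -/
theorem continuous_ursellOf_moment_matrix (j : ℕ) :
    Continuous fun M : Matrix (Fin (j * 2 + 1)) (Fin (j * 2 + 1)) ℂ =>
      ursellOf (FermionicTree.moment (hubbardCluster j) M) univ :=
  FermionicTree.continuous_ursellOf (fun M P => FermionicTree.moment (hubbardCluster j) M P)
    (fun P => FermionicTree.continuous_moment (hubbardCluster j) (fun M => M)
      (fun a b => (continuous_apply b).comp (continuous_apply a)) P) _

/-- **The truncated expectation with vertices at fixed integer positions converges as `L → ∞`.**
[cite: BenfattoGiulianiMastropietro2006, §2.3 footnote 1] -/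
theorem tendsto_twoPointUrsellZ (x y : Site 2) (σ σ' : Fin 2) {j : ℕ} (Z : Fin j → Site 2)
    (τ : Fin j → ℂ) :
    Tendsto (fun L : ℕ => twoPointUrsellZ β μ L x y σ σ' Z τ) atTop
      (𝓝 (twoPointUrsellInf β μ x y σ σ' Z τ)) := by
  have hM : Tendsto (fun L : ℕ => torusWordMatrix β μ L x y σ σ' Z τ) atTop
      (𝓝 (infWordMatrix β μ x y σ σ' Z τ)) :=
    tendsto_pi_nhds.2 fun a => tendsto_pi_nhds.2 fun b => tendsto_torusWordMatrix_apply β μ x y σ σ' Z τ a b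
  exact ((continuous_ursellOf_moment_matrix j).tendsto _).comp hM

variable {L : ℕ} [NeZero L]

/-- Bridge for the truncated expectation: `twoPointUrsell` of `HubbardLinkedCluster` for the torus
and vertices `proj ∘ Z` is `twoPointUrsellZ`. [folklore] -/
theorem twoPointUrsell_torus_eq (x y : Site 2) (σ σ' : Fin 2) {j : ℕ} (Z : Fin j → Site 2)
    (τ : Fin j → ℂ) :
    twoPointUrsell β (hubbardOneBody (fermionTorusGraph 2 L) 1 μ)
        (orb (FermionTorus.ofTorusSite (Torus.proj L x)) σ)
        (orb (FermionTorus.ofTorusSite (Torus.proj L y)) σ')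
        (fun i => FermionTorus.ofTorusSite (Torus.proj L (Z i))) τ =
      twoPointUrsellZ β μ L x y σ σ' Z τ := by
  unfold twoPointUrsell twoPointUrsellZ
  rw [twoPointPropMatrix_torus_eq]

/-! ### Summing over the torus positions through the centred representatives -/

/-- A configuration of integer positions is **centred** (for the torus of side `L`) if every
position is the centred representative of its class. [folklore] -/
def IsCentred (L : ℕ) {j : ℕ} (Z : Fin j → Site 2) : Prop :=
  ∀ i, Torus.cRep (Torus.proj L (Z i)) = Z i

/-- Centredness is decidable. [folklore] -/
instance (L : ℕ) {j : ℕ} (Z : Fin j → Site 2) : Decidable (IsCentred L Z) := by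
  unfold IsCentred; infer_instance

/-- Centred representatives are centred. [folklore] -/
theorem isCentred_cRep {j : ℕ} (G : Fin j → TorusSite 2 L) : IsCentred L fun i => Torus.cRep (G i) :=
  fun i => by rw [Torus.proj_cRep]

/-- **The sum over torus positions is the sum over centred integer positions**: for any `Ψ`,
`Σ_{g ∈ Λ_L^j} Ψ(proj-lift of g) = Σ'_{Z ∈ (ℤ²)^j} [Z centred] Ψ(Z)` — here for the truncated
expectation: `Σ_g 𝓔ᵀ(… g …) = Σ'_Z [Z centred] twoPointUrsellZ Z`. [folklore] -/
theorem sum_twoPointUrsell_torus_eq_tsum (x y : Site 2) (σ σ' : Fin 2) (j : ℕ) (τ : Fin j → ℂ) :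
    ∑ g : Fin j → FermionTorus 2 L, twoPointUrsell β (hubbardOneBody (fermionTorusGraph 2 L) 1 μ)
        (orb (FermionTorus.ofTorusSite (Torus.proj L x)) σ)
        (orb (FermionTorus.ofTorusSite (Torus.proj L y)) σ') g τ =
      ∑' Z : Fin j → Site 2, if IsCentred L Z then twoPointUrsellZ β μ L x y σ σ' Z τ else 0 := by
  classical
  -- Step 1: index the torus positions by `TorusSite` and lift them to their centred representatives
  set e : (Fin j → FermionTorus 2 L) ≃ (Fin j → TorusSite 2 L) :=
    Equiv.arrowCongr (Equiv.refl (Fin j)) FermionTorus.equivTorusSite with he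
  have h1 : ∑ g : Fin j → FermionTorus 2 L, twoPointUrsell β (hubbardOneBody (fermionTorusGraph 2 L) 1 μ)
        (orb (FermionTorus.ofTorusSite (Torus.proj L x)) σ)
        (orb (FermionTorus.ofTorusSite (Torus.proj L y)) σ') g τ =
      ∑ G : Fin j → TorusSite 2 L, twoPointUrsellZ β μ L x y σ σ' (fun i => Torus.cRep (G i)) τ := by
    rw [← e.symm.sum_comp]
    refine sum_congr rfl fun G _ => ?_
    have hG : e.symm G = fun i => FermionTorus.ofTorusSite (Torus.proj L (Torus.cRep (G i))) := by
      funext i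
      simp [he, Equiv.arrowCongr, FermionTorus.equivTorusSite]
    rw [hG, twoPointUrsell_torus_eq]
  rw [h1]
  -- Step 2: the finite sum over `G` as a sum over the (injective) image `cRep ∘ G`, then as a `tsum`
  set T : Finset (Fin j → Site 2) := univ.image fun G : Fin j → TorusSite 2 L => fun i => Torus.cRep (G i)
    with hT
  have hinj : Function.Injective fun G : Fin j → TorusSite 2 L => fun i => Torus.cRep (G i) := by
    intro G G' h
    funext i
    exact Torus.cRep_injective (congr_fun h i)
  rw [tsum_eq_sum (s := T) fun Z hZ => ?_, hT, sum_image fun G _ G' _ h => hinj h]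
  · refine sum_congr rfl fun G _ => ?_
    rw [if_pos (isCentred_cRep G)]
  · rw [if_neg]
    intro hc
    refine hZ (mem_image.2 ⟨fun i => Torus.proj L (Z i), mem_univ _, ?_⟩)
    funext i
    exact hc i

omit [NeZero L] in
/-- A fixed configuration is centred for all large `L`. [folklore] -/
theorem eventually_isCentred {j : ℕ} (Z : Fin j → Site 2) : ∀ᶠ L : ℕ in atTop, IsCentred L Z := by
  set M : ℕ := univ.sup fun i => Site.supNorm (Z i) with hM
  refine (eventually_gt_atTop (2 * M)).mono fun L hL i => ?_
  haveI : NeZero L := ⟨by omega⟩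
  exact Torus.cRep_proj_of_mem_box hL (mem_box_iff_supNorm_le.2 (Finset.le_sup (f := fun i => Site.supNorm (Z i)) (mem_univ i)))

end Limit

end Literature.MathematicalPhysics.QuantumLattice

end
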